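import Literature.AlgebraicGeometry.GroupSchemes.CartierDualQuotient
import Literature.AlgebraicGeometry.GroupSchemes.CartierDualAlgBaseChange
import Literature.AlgebraicGeometry.GroupSchemes.BarsottiTateGroupBaseChange
import Mathlib.RingTheory.LocalRing.Module
import Mathlib.LinearAlgebra.DirectSum.Finsupp
import HarnessLib

/-!
# The annihilator `H^⊥` of a finite free closed subgroup has constant fibre rank `rk G ⁄ rk H`, hence is FREE over a local domain:
# the quotient `G⧸H = (H^⊥)^D` exists over valuation rings and DVRs (Tate 1997 (3.7); EGA IV₂ 2.8)

Layer `Literature/AlgebraicGeometry/GroupSchemes`, namespace `Literature.AlgebraicGeometry.GroupSchemes.AffineGroupScheme` (§2–§3; §1 in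
`Literature.AlgebraicGeometry.GroupSchemes`) (continues ★ `CartierDualAnnihilator(Rank)` p845459 ∕ p845797, ★ `CartierDualAnnihilatorBaseChange` p846227 —
`annihilatorBaseChangeIso : (H^⊥)_{R′} ≅ (H_{R′})^⊥` —, ★ `CartierDualQuotient` p846266 — `quot j := (H^⊥)^D` under the one instance hypothesis
`[Module.Free R (Alg (annihilator j))]` —, ★ `CartierDualAlgBaseChange` — `free_∕finite_alg_baseChange` —, ★ `BarsottiTateGroupBaseChange` — `of_pullback_map_left` —).
THEOREMS ONLY (no definition, no instance, no notation, no named fact, no `sorry`).  Cell `hodgecm-mathlib` (D-0151), programme P6 «MOD», organ (FLAT⊥) of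
B-p04 (g38).  Count-neutral Mathlib-side capital: HC_CM is proved only modulo the printed citations until rung 0 closes; nothing here bears on it.

THE PRINT ([Tate1997FiniteFlatGroupSchemes] (3.7): for a finite flat closed subgroup `H ⊂ G` of a finite flat commutative group scheme over any base,
`G⧸H` exists and is finite flat of order `[G : H]`, and `(G⧸H)^D = H^⊥`; [EGAIV2] §2.8 ∕ [Matsumura1987] Thm. 7.10: a finite module over a local ring is
free iff flat, and flatness over an integral base is detected by constancy of the fibre rank).  HERE, for a homomorphism `j : H ⟶ G` of finite free
commutative affine group objects of `SchemeOver R` whose underlying morphism is a closed immersion: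

* §1 ALGEBRA **`free_of_finrank_tensor_eq_finrank_residueField_tensor`**: a finite module `M` over a LOCAL DOMAIN `R` with
  `dim_K (K ⊗_R M) = dim_κ (κ ⊗_R M)` (`K = Frac R`, `κ` the residue field) is FREE — lift a `κ`-basis (Nakayama, Mathlib
  `IsLocalRing.span_eq_top_of_tmul_eq_basis`) to `r` generators; the surjection `R^r → M` becomes, after `K ⊗ -`, a surjection of `K`-spaces of equal
  dimension, hence injective, and `R^r ↪ K^r`.
* §2 (ANY `R`, any `R`-algebra FIELD `L`) **`finrank_tensor_alg_annihilator_mul_finrank : dim_L (L ⊗_R Γ(H^⊥)) · rk_R Γ(H) = rk_R Γ(G)`** — the fibre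
  ranks of `H^⊥` are CONSTANT: `L ⊗ Γ(H^⊥) ≅ Γ((H^⊥)_L) ≅ Γ((H_L)^⊥)` (★ `algBaseChangeEquiv`, ★ `annihilatorBaseChangeIso`; `j_L` is again a closed immersion,
  ★ `of_pullback_map_left`) and the field rank clause ★ `finrank_alg_annihilator_mul_finrank`, with `rk_L Γ(X_L) = rk_R Γ(X)` for `X` finite free.
* §3 (`R` a LOCAL DOMAIN, e.g. a valuation ring `𝒪_Ω` or `𝒪_{F,w}`) **`free_alg_annihilator : Module.Free R (Alg (annihilator j))`**,
  **`finrank_alg_annihilator_mul_finrank_of_isLocalRing : rk Γ(H^⊥) · rk Γ(H) = rk Γ(G)`**, and for the quotient of ★ `CartierDualQuotient`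
  (`haveI := free_alg_annihilator K j`): **`finrank_alg_quot_mul_finrank_of_isLocalRing : rk Γ(G⧸H) · rk Γ(H) = rk Γ(G)`** — Tate's «`G⧸H` exists, finite
  flat of order `[G : H]`» over local domains.

NOT here: general (non-local, non-domain) bases (there `H^⊥` is finite locally free by the same fibre count plus a flatness criterion over reduced bases);
«annihilators commute with flat closure» (sequel: uniqueness of flat closures ★ `IdealClosureGenericFibre` + §3).

## References
* [Tate1997FiniteFlatGroupSchemes] J. Tate, *Finite flat group schemes*, in: Modular Forms and Fermat's Last Theorem (1997), (3.7), §(3.8) pp. 145–146.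
* [EGAIV2] A. Grothendieck, J. Dieudonné, *ÉGA* IV₂, Publ. Math. IHÉS 24 (1965), §2.8 (Prop. 2.8.5).
* [Matsumura1987] H. Matsumura, *Commutative Ring Theory* (1987), Thm. 2.4, Thm. 7.10.
-/

set_option autoImplicit false

-- Mathlib's `Over`/`Scheme` APIs are stated across semireducible wrappers (as in the ★ `GroupSchemes/*` files).
set_option backward.isDefEq.respectTransparency false

universe u v

open CategoryTheory CategoryTheory.Limits AlgebraicGeometry MonoidalCategory CartesianMonoidalCategory TensorProduct WithConv

noncomputable section

namespace Literature.AlgebraicGeometry.GroupSchemes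

/-! ## §1 Algebra: a finite module over a local domain with equal generic and residual ranks is free -/

/-- **A finite module `M` over a local domain `R` with `dim_K (K ⊗_R M) = dim_κ (κ ⊗_R M)` is FREE** (`K = Frac R`, `κ` the residue field): a `κ`-basis
of `κ ⊗ M` lifts to `r` generators of `M` (Nakayama), the surjection `R^r → M` tensored with `K` is a surjection between `K`-spaces of the same dimension
`r`, hence injective, and `R^r → K ⊗ R^r ≅ K^r` is injective; so `R^r ≅ M`.  ([Matsumura1987] Thm. 2.4 (Nakayama); the rank bookkeeping of [EGAIV2] 2.8.)
[cite: Matsumura1987, Thm. 2.4 and Thm. 7.10] -/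
theorem free_of_finrank_tensor_eq_finrank_residueField_tensor {R : Type u} [CommRing R] [IsDomain R] [IsLocalRing R]
    (K : Type u) [Field K] [Algebra R K] [IsFractionRing R K] (M : Type v) [AddCommGroup M] [Module R M] [Module.Finite R M]
    (h : Module.finrank K (K ⊗[R] M) = Module.finrank (IsLocalRing.ResidueField R) (IsLocalRing.ResidueField R ⊗[R] M)) :
    Module.Free R M := by
  classical
  set k := IsLocalRing.ResidueField R
  -- a `κ`-basis of `κ ⊗ M`, lifted to `M`, spans `M` (Nakayama)
  let w := Module.Free.chooseBasis k (k ⊗[R] M)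
  obtain ⟨v, hv⟩ := (TensorProduct.mk_surjective R M k Ideal.Quotient.mk_surjective).comp_left w
  have hspan : Submodule.span R (Set.range v) = ⊤ := IsLocalRing.span_eq_top_of_tmul_eq_basis v w (congr_fun hv)
  let ι := Module.Free.ChooseBasisIndex k (k ⊗[R] M)
  have hcard : Fintype.card ι = Module.finrank K (K ⊗[R] M) := by
    rw [h]; exact (Module.finrank_eq_card_basis w).symm
  -- the linear combination map `R^ι → M` is surjective
  let lc : (ι →₀ R) →ₗ[R] M := Finsupp.linearCombination R v
  have hlc : Function.Surjective lc := by
    rw [← LinearMap.range_eq_top, Finsupp.range_linearCombination, hspan]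
  -- after `K ⊗ -` it is a surjection between spaces of the same finite dimension, hence injective
  have hsurjK : Function.Surjective (lc.baseChange K) := by
    rw [LinearMap.baseChange_eq_ltensor]
    exact LinearMap.lTensor_surjective K hlc
  have hdim : Module.finrank K (K ⊗[R] (ι →₀ R)) = Module.finrank K (K ⊗[R] M) := by
    rw [← hcard, (TensorProduct.finsuppScalarRight R K K ι).finrank_eq, Module.finrank_finsupp_self]
  have hinjK : Function.Injective (lc.baseChange K) :=
    (LinearMap.injective_iff_surjective_of_finrank_eq_finrank hdim).mpr hsurjK
  -- `x ↦ 1 ⊗ x : R^ι → K ⊗ R^ι` is injective (`R → K` is), hence so is `lc`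
  have hinc : Function.Injective (TensorProduct.mk R K (ι →₀ R) 1) := by
    intro x y hxy
    ext i
    have hx := congrArg (fun z => TensorProduct.finsuppScalarRight R K K ι z i) hxy
    simp only [TensorProduct.mk_apply, TensorProduct.finsuppScalarRight_apply_tmul_apply] at hx
    rw [← Algebra.algebraMap_eq_smul_one, ← Algebra.algebraMap_eq_smul_one] at hx
    exact IsFractionRing.injective R K hx
  have hinj : Function.Injective lc := by
    intro x y hxy
    apply hinc
    apply hinjK
    rw [TensorProduct.mk_apply, TensorProduct.mk_apply, LinearMap.baseChange_tmul, LinearMap.baseChange_tmul, hxy]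
  exact Module.Free.of_basis (Module.Basis.mk (v := v) (linearIndependent_iff_injective_finsuppLinearCombination.mpr hinj) hspan.ge)

namespace AffineGroupScheme

open scoped MonObj CategoryTheory.Obj

open Literature.AlgebraicGeometry.Motives Literature.NumberTheory.DiophantineGeometry Literature.RingTheory.HopfAlgebra GroupSchemeKernel

/-! ## §2 The fibre ranks of `H^⊥` are constant -/

section FibreRank

variable {R : Type u} [CommRing R] (L : Type u) [Field L] [Algebra R L] {H G : SchemeOver R}
  [GrpObj H] [IsCommMonObj H] [IsAffine H.left] [Module.Free R (Alg H)] [Module.Finite R (Alg H)]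
  [GrpObj G] [IsCommMonObj G] [IsAffine G.left] [Module.Free R (Alg G)] [Module.Finite R (Alg G)]
  (j : H ⟶ G) [IsMonHom j]

omit [GrpObj H] [IsCommMonObj H] [Module.Free R (Alg H)] [Module.Finite R (Alg H)] [GrpObj G] [IsCommMonObj G] [Module.Free R (Alg G)]
  [Module.Finite R (Alg G)] [IsMonHom j] in
/-- An isomorphism of affine `L`-schemes induces an `L`-algebra isomorphism of global sections (★ `Alg.comap` functoriality).
[cite: GortzWedhorn2020, Section (4.7), (4.7.1) (p. 108)] -/
theorem nonempty_algEquiv_of_iso {X Y : SchemeOver L} (e : X ≅ Y) : Nonempty (Alg Y ≃ₐ[L] Alg X) :=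
  ⟨AlgEquiv.ofAlgHom (Alg.comap e.hom) (Alg.comap e.inv) (by rw [← Alg.comap_comp, e.hom_inv_id, Alg.comap_id])
    (by rw [← Alg.comap_comp, e.inv_hom_id, Alg.comap_id])⟩

omit [IsCommMonObj H] [Module.Finite R (Alg H)] [GrpObj G] [IsCommMonObj G] [Module.Free R (Alg G)] [Module.Finite R (Alg G)] [IsAffine G.left] in
/-- `rk_L Γ(H_L) = rk_R Γ(H)` for `Γ(H)` free (★ `algBaseChangeEquiv` + Mathlib `Module.finrank_baseChange`). [cite: GortzWedhorn2020, Section (4.7), (4.7.1) (p. 108)] -/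
theorem finrank_alg_pullback_obj :
    Module.finrank L (Alg ((Over.pullback (Spec.map (CommRingCat.ofHom (algebraMap R L)))).obj H)) = Module.finrank R (Alg H) := by
  haveI := isAffine_pullback_obj_left L H
  haveI : Nontrivial R := (algebraMap R L).domain_nontrivial
  rw [(algBaseChangeEquiv L H).toLinearEquiv.finrank_eq]
  exact Module.finrank_baseChange (R := L) (S := R) (M' := Alg H)

/-- **THE FIBRE RANKS OF `H^⊥` ARE CONSTANT: `dim_L (L ⊗_R Γ(H^⊥)) · rk_R Γ(H) = rk_R Γ(G)`** for every `R`-algebra field `L` and every homomorphism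
`j : H → G` of finite free commutative affine group schemes over `R` whose underlying morphism is a closed immersion:
`L ⊗ Γ(H^⊥) ≅ Γ((H^⊥)_L)` (★ `algBaseChangeEquiv`) `≅ Γ((H_L)^⊥)` (★ `annihilatorBaseChangeIso`), `j_L` is a closed immersion (★ `of_pullback_map_left`), and the
field rank clause ★ `finrank_alg_annihilator_mul_finrank` reads `rk (H_L)^⊥ · rk H_L = rk G_L` with `rk_L Γ(X_L) = rk_R Γ(X)`.
[cite: Tate1997FiniteFlatGroupSchemes, (3.7)] [cite: EGAIV2, §2.8 (Prop. 2.8.5)] -/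
theorem finrank_tensor_alg_annihilator_mul_finrank [IsClosedImmersion j.left] :
    Module.finrank L (L ⊗[R] Alg (annihilator j)) * Module.finrank R (Alg H) = Module.finrank R (Alg G) := by
  -- the base-changed objects are affine, commutative, with finite free algebras over the field `L`
  haveI := isAffine_pullback_obj_left L H
  haveI := isAffine_pullback_obj_left L G
  haveI := isAffine_pullback_obj_left L (annihilator j)
  haveI := isAffine_pullback_obj_left L (cartierDual H)
  haveI := isAffine_pullback_obj_left L (cartierDual G)
  haveI : IsCommMonObj ((Over.pullback (Spec.map (CommRingCat.ofHom (algebraMap R L)))).obj H) := inferInstance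
  haveI : IsCommMonObj ((Over.pullback (Spec.map (CommRingCat.ofHom (algebraMap R L)))).obj G) := inferInstance
  haveI := finite_alg_baseChange L H
  haveI := finite_alg_baseChange L G
  haveI := free_alg_baseChange L H
  haveI := free_alg_baseChange L G
  haveI : IsClosedImmersion ((Over.pullback (Spec.map (CommRingCat.ofHom (algebraMap R L)))).map j).left :=
    of_pullback_map_left _ (P := @IsClosedImmersion) j inferInstance
  -- `L ⊗ Γ(H^⊥) ≅ Γ((H^⊥)_L) ≅ Γ((H_L)^⊥)`
  obtain ⟨e⟩ := nonempty_algEquiv_of_iso L (annihilatorBaseChangeIso L j)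
  have h1 : Module.finrank L (L ⊗[R] Alg (annihilator j)) =
      Module.finrank L (Alg (annihilator ((Over.pullback (Spec.map (CommRingCat.ofHom (algebraMap R L)))).map j))) := by
    rw [← (algBaseChangeEquiv L (annihilator j)).toLinearEquiv.finrank_eq, ← e.toLinearEquiv.finrank_eq]
  rw [h1, ← finrank_alg_pullback_obj L (H := H), ← finrank_alg_pullback_obj L (H := G),
    finrank_alg_annihilator_mul_finrank ((Over.pullback (Spec.map (CommRingCat.ofHom (algebraMap R L)))).map j)]

end FibreRank

/-! ## §3 Over a local domain `H^⊥` is free, so `G⧸H = (H^⊥)^D` exists -/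

section LocalDomain

variable {R : Type u} [CommRing R] [IsDomain R] [IsLocalRing R] (K : Type u) [Field K] [Algebra R K] [IsFractionRing R K] {H G : SchemeOver R}
  [GrpObj H] [IsCommMonObj H] [IsAffine H.left] [Module.Free R (Alg H)] [Module.Finite R (Alg H)]
  [GrpObj G] [IsCommMonObj G] [IsAffine G.left] [Module.Free R (Alg G)] [Module.Finite R (Alg G)]
  (j : H ⟶ G) [IsMonHom j] [IsClosedImmersion j.left]

include K in
/-- **`Γ(H^⊥)` IS FREE OVER A LOCAL DOMAIN** (e.g. a valuation ring `𝒪_Ω`, or `𝒪_{F,w}`): its generic and residual ranks are both `rk G ⁄ rk H` (§2 at `L = K`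
and `L = κ`), so §1 applies. [cite: Tate1997FiniteFlatGroupSchemes, (3.7)] [cite: Matsumura1987, Thm. 2.4 and Thm. 7.10] -/
theorem free_alg_annihilator : Module.Free R (Alg (annihilator j)) := by
  refine free_of_finrank_tensor_eq_finrank_residueField_tensor K (Alg (annihilator j)) ?_
  have hH : 0 < Module.finrank R (Alg H) := by
    rw [← finrank_alg_pullback_obj K (H := H)]
    haveI := isAffine_pullback_obj_left K H
    haveI := finite_alg_baseChange K H
    exact finrank_alg_pos (H := (Over.pullback (Spec.map (CommRingCat.ofHom (algebraMap R K)))).obj H)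
  refine Nat.eq_of_mul_eq_mul_right hH ?_
  rw [finrank_tensor_alg_annihilator_mul_finrank K j, finrank_tensor_alg_annihilator_mul_finrank (IsLocalRing.ResidueField R) j]

include K in
/-- **`rk_R Γ(H^⊥) · rk_R Γ(H) = rk_R Γ(G)` over a local domain** (`H^⊥` free of the constant fibre rank). [cite: Tate1997FiniteFlatGroupSchemes, (3.7)] -/
theorem finrank_alg_annihilator_mul_finrank_of_isLocalRing :
    Module.finrank R (Alg (annihilator j)) * Module.finrank R (Alg H) = Module.finrank R (Alg G) := by
  haveI := free_alg_annihilator K j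
  haveI : Nontrivial R := (algebraMap R K).domain_nontrivial
  rw [← Module.finrank_baseChange (R := K) (S := R) (M' := Alg (annihilator j))]
  exact finrank_tensor_alg_annihilator_mul_finrank K j

include K in
/-- **TATE (3.7) OVER A LOCAL DOMAIN: `G⧸H = (H^⊥)^D` EXISTS AND HAS ORDER `[G : H]`** — with `haveI := free_alg_annihilator K j` the quotient ★ `quot j` of
★ `CartierDualQuotient` is a finite free commutative group scheme over `R` (all ★ `cartierDual.inst*`), and `rk_R Γ(G⧸H) · rk_R Γ(H) = rk_R Γ(G)`
(★ `finrank_alg_cartierDual`). [cite: Tate1997FiniteFlatGroupSchemes, (3.7)] -/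
theorem finrank_alg_quot_mul_finrank_of_isLocalRing :
    letI := free_alg_annihilator K j
    Module.finrank R (Alg (quot j)) * Module.finrank R (Alg H) = Module.finrank R (Alg G) := by
  letI := free_alg_annihilator K j
  rw [finrank_alg_cartierDual (annihilator j)]
  exact finrank_alg_annihilator_mul_finrank_of_isLocalRing K j

end LocalDomain

end AffineGroupScheme

end Literature.AlgebraicGeometry.GroupSchemes

end
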